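import Literature.MathematicalPhysics.QuantumFieldTheory.Balaban1983to89.B9Ineq349MultiLevelBoxL0
import Literature.MathematicalPhysics.QuantumFieldTheory.Balaban1983to89.B6Prop23MultiLevelBoxL0
import Literature.MathematicalPhysics.QuantumFieldTheory.Balaban1983to89.B8ScaledSupNorm
import Literature.MathematicalPhysics.QuantumFieldTheory.Balaban1983to89.B6Geom246MultiLevelBoxL0
import Literature.MathematicalPhysics.QuantumFieldTheory.Balaban1983to89.B6Ineq268MultiLevelBoxL0
import Literature.MathematicalPhysics.QuantumFieldTheory.Balaban1983to89.B6MultiLevelBoxOperatorL0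
import Literature.MathematicalPhysics.QuantumFieldTheory.Balaban1983to89.B6Prop22AllMultiLevelBoxL0
import Literature.MathematicalPhysics.QuantumFieldTheory.Balaban1983to89.B8Ineq192MultiLevelBoxL0

/-!
# `Balaban1983to89.B8Ineq198MultiLevelBoxL0` — LEVEL-0 TWIN (programme G-F3′-L0, sub-row G-F3′-L0∕B8 «N05 cone»; director-ym LINE №27 ∕ №35, UV3-NODE §24.5; plan `lit-balaban-r03/G-F3L0-PLAN.md`, row log `lit-balaban-lead/ROW-G-F3p-L0.md` §7) of `B8Ineq198MultiLevelBox`: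
the same declarations, SAME NAMES AND STATEMENTS, for nested families WITH print's region `Λ₀ = T ∖ Ω₁` ADMITTED (structures
`B6MultiLevelBoxOperatorL0.Domains` / `B6MultiLevelTorusOperatorL0.TDomains`: levels `0, …, k`, the level-`0` block a single site, `Q′₀ = id`,
finite weight `a₀` — print p.225 (2.14) «Σ_{j=0}^k … (Q′₀λ)(x) = λ(x), x ∈ Λ₀», p.229 «taking a sequence (2.1) … smallest possible domains B^j(Λ_j),
and considering the operator Δ_a defined by (2.19), (2.20) for this sequence»).  Every `D`-free object is the lineage's, consumed BY NAME; no existing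
module is touched; no fact is minted.  Unit `lit-balaban-p38` (p38 gen 36; second hand of sub-row G-F3′-L0∕B8 «N05 cone» — director-ym №35 2026-08-27T23:07:41Z, OWNER `lit-balaban-r05`, consumer pub-ymgap∕dag-n05-c by endpoint name; port discipline and tooling r03 gen 36∕37, PLAN v1.5); B8 fold owner r05, B9 fold owner r06; referee ref-4.  THE TWIN'S DOCUMENTATION FOLLOWS
VERBATIM (its «levels 1 … k» / «Ω₁ = X» sentences describe the twin; here `j` runs from `0` and `Ω₁` may be a proper subset).

# `Balaban1983to89.B8Ineq198MultiLevelBox` — T. Bałaban, *Spaces of regular gauge field configurations on a lattice and gauge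
# fixing conditions*, Commun. Math. Phys. **99** (1985) 75–102 [Balaban1985RegularSpaces], p. 92 **(1.98), R-half «|Rf|₍₋₂₎ ≦
# B′₀|f|₍₋₂₎»** and p. 93 **(1.101) «G′ is a bounded operator from a space with the norm |·|₍₋₂₎ into a space with the norm |·|
# for functions, and the norm |·|₍₋₁₎ for their first derivatives»** — **AT U₀ = 1 ON THE GENUINE `k`-LEVEL NEUMANN-BOX FAMILY OF
# [B6] §2** (an ARBITRARY nested sequence of block-union domains X = Ω₁ ⊃ … ⊃ Ω_k with (2.1)–(2.2)), for the GENUINE multi-level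
# `G′ = Δ′_a⁻¹`, `Q′`, `Q′*` and the projection `R = I − G′Q′*(Q′G′²Q′*)⁻¹Q′G′` of [4] (3.25): `_of_inverse` forms (EVERY `G` on `𝔅`
# with the printed (2.87)-bound of `(Q′G′²Q′*)⁻¹`) and HYPOTHESIS-FREE forms (THE inverse, `B6Prop23MultiLevelBoxL0.prop23_multiLevelBox`)

statement-level skeleton of published theorems with citation tags; proofs where landed; nothing here is a claim about the Yang–Mills mass gap

PDF held: `paper:balaban1985-cmp99-regular-spaces-gauge-fixing` (journal page = PDF page + 74); text layer re-read this generation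
(`lit read … --pages 17-25`): p. 92 [PDF 18] l. 17–18 and (1.98), p. 93 [PDF 19] (1.100)–(1.102).  The norms are B8 p. 86 [PDF 12]
«|A|₍α₎ = sup_j sup_{Ω_j} (Lʲη)^{−α}|A|» = [4] (3.41) p. 397 («For α negative we can take Ω_j instead of Ω_j∖Ω_{j+1}»).

CITATION HEADER (lean-in-tree rule).  Cell `lit-balaban` (HOME `run/shared/lean/pub/lit-balaban/`), unit `lit-balaban-r05` gen 45
(B8 reader/typer and fold owner; free target under protocol G.5-34(d), HOME/STATUS 2026-08-22T17:56Z; the announced continuation of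
`B8Ineq192MultiLevelBox` p333386 / `B8Ineq192MultiLevelBoxP23` p335269 / `B9Ineq349MultiLevelBox` p334945, HOME/lit-balaban-r05/HANDOFF.md
§§ gen 43–44).  WHAT IS REPRODUCED = SKELETON rows **B8.Claim@92** (second time, now in the WEIGHTED norm), **B8.Eq1.99** member (1.98)
R-half and **B8.Eq1.101** (the G′ sentence), as «kernel-checked proofs of a model instance» on the multi-level flat carriers of p21's
`B6Geom246MultiLevelBox` / `B6MultiLevelBoxOperator` (the `k`-level Neumann-box family `Domains d ℓ M_h k P R`).

WHAT IS PRINTED (verbatim).  p. 92 [PDF 18]: *"Let us recall that from Theorems 3.1, 3.2 of [4] it follows that |Rf| ≦ B′₀|f|, hence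
the operator R[…]R has a L^∞ norm bounded by O(α₄)B′₀²."* … *"Thus it is a function with a bounded norm |·|₍₋₂₎.  The operators R
and V are bounded in this norm, and we have |Rf|₍₋₂₎ ≦ B′₀|f|₍₋₂₎, |Vf|₍₋₂₎ ≦ O(α₄)|f|₍₋₂₎. (1.98)"*; p. 93 [PDF 19]: *"Equations
(1.95) can be changed into the equivalent equation λ = G′RD\*A + G′R𝔉₄(λ, Dλ, A, D\*A). (1.100) … One of the results of [4], Theorem
3.1, tells us that G′ is a bounded operator from a space with the norm |·|₍₋₂₎ into a space with the norm |·| for functions, and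
the norm |·|₍₋₁₎ for their first derivatives. Thus we have |G′R𝔉(λ, Dλ, A, D\*A)|, |DG′R𝔉(λ, Dλ, A, D\*A)|₍₋₁₎ ≦ O(1)B′₀ξ₁(α₀ + α₁
+ 3α₄²) on Ω_j (1.101)"*.  [4] = T. Bałaban, *Propagators for lattice gauge theories in a background field*, Commun. Math. Phys.
**99** (1985) 389–434 [Balaban1985BackgroundPropagators]: (3.41) p. 397, (3.47) p. 398 «Using Lemma 2.1 in [4] we may replace the
factor (Lʲη)^α by (Lʲη)^β(L^{j′}η)^γ with β + γ = α», (3.49) p. 399, (3.25) p. 394, and p. 399 «This way the theorems are reduced to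
the corresponding theorems for propagators without external gauge field. They were proved in [4].» ([B6] = T. Bałaban, *Propagators
and renormalization transformations for lattice gauge theories. II*, Commun. Math. Phys. **96** (1984) 223–250
[Balaban1984PropagatorsII]: Prop. 2.2 (2.67) p. 234, Prop. 2.3 (2.87) p. 238, Lemma 2.1 (2.60)–(2.61) p. 234, (2.52)–(2.55) p. 232,
(2.69) p. 235).

STATUS IN THE TREE BEFORE THIS FILE (read first; nothing below restates it).  (1.98) R-half and (1.101) are NAMED HYPOTHESES of the
Sect. D certification `B8SectDSource` (`‖R‖ ≤ B′₀` on the |·|₍₋₂₎-space in §3 / `propFive_source`; `‖G′‖ ≤ B′₀` from the |·|₍₋₂₎-space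
to the `max{|λ|, |Dλ|₍₋₁₎}`-space in §4 `ineq1101`).  At [4]'s FUNCTION level (abstract block-majorant letters of printed shape) they are
`B8Ineq198R.ineq198_R` / `ineq198_R_of_thms3132` (r05 g13) and `B9Ineq347AllEntries` (p27).  ON THE GENUINE `k`-LEVEL BOX FAMILY AT
U₀ = 1 the tree has: the Prop.-2.2 majorants of the genuine `G′` (`B6Prop22AllMultiLevelBoxL0.prop22_entries1236_multiLevelBox`, p21), THE
inverse `(Q′G′²Q′*)⁻¹` with (2.87) (`B6Prop23MultiLevelBoxL0.prop23_multiLevelBox`, p21), the SUP-norm sentence «|Rf| ≦ B′₀|f|»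
(`B8Ineq192MultiLevelBoxL0.rProjML_sup_bound_of_inverse` / `…P23.rProjML_sup_bound`, r05 g43–44) and the four (3.49) kernel bounds of
`P = I − R` (`B9Ineq349MultiLevelBoxL0.ineq349_multiLevelBox_of_inverse` / `…P23`, r05 g44).  NOT in the tree before this file: the
WEIGHTED forms — (1.98) R-half and (1.101) — on these carriers.

WHAT THIS FILE PROVES (theorems only; 0 `def`, 0 new facts, 0 sorry; every input BY NAME; imports `B9Ineq349MultiLevelBox`
(⊇ `B8Ineq192MultiLevelBox` ⊇ p21's chain), `B6Prop23MultiLevelBox`, `B8ScaledSupNorm`).  Weights read at the point's own level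
`j = D.lev x` («For α negative we can take Ω_j», [4] p. 397): «|f|₍₋ₙ₎ ≦ S» ⟺ `|f(z)| ≦ S·(L^{j(z)})⁻ⁿ` for all fine points `z`.
* §1 ENGINE (two lemmas on top of `B8Ineq192MultiLevelBox` §§2–3): `hasMajorant_of_kernelBound` — a fine-lattice operator whose
  matrix entries obey `|T(x, x′)| ≦ B·W(y(x′))⁻¹·e^{−ρd(y(x),y(x′))}` (the shape of the (3.49) entries, `W(y′) = (L^{j′})^{d+1} ≥ #B(y′)`)
  has the block majorant `B·e^{−ρd(y,y′)}` ((2.51)/(2.55) shape); `apply_le_of_invPow` — a block majorant `C·p(y)·e^{−σd(y,y′)}`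
  applied to an input with `|u(z)| ≦ A·(L^{j(z)})⁻ⁿ` gives `|(Tu)(x)| ≦ A·C·p(y(x))·Lⁿc·(L^{j(x)})⁻ⁿ` under (2.60) (`Lⁿ ≦ e^{β(RM−1)}`:
  the weight `(L^{j′})⁻ⁿ` moved to `x`, [4] p. 398 «we may replace the factor (Lʲη)^α by (Lʲη)^β(L^{j′}η)^γ») and (2.61) (row sums
  `≦ c` at a rate `τ`, `τ + β ≦ σ`) — `abs_apply_le_of_levelBound` + `inv_pow_len_le` + `levelRowSum_le` of r05 g43.
* §2 **`ineq198R_multiLevelBox_of_inverse`** — for every exponent `n` and every `C₁, δ₁ > 0`: `∃ B′₀ > 0, M₀ > 0, N₀ ≥ 1` (functions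
  of `d, ℓ`, the weight windows, `C₁, δ₁, n`) such that on every member of the family (thresholds `L·M_h ≥ M₀`, `R·L·M_h ≥ N₀ + 1`),
  for EVERY `G` on `𝔅` with the (2.87)-bound, every `f` with `|f(z)| ≦ S(L^{j(z)})⁻ⁿ`: `|(Pf)(x)| ≦ B′₀(L^{j(x)})⁻ⁿS` and
  **`|(Rf)(x)| ≦ B′₀(L^{j(x)})⁻ⁿS`** (`R = rProjML = 1 − pProjML`); `n = 2` is the printed (1.98) R-half «|Rf|₍₋₂₎ ≦ B′₀|f|₍₋₂₎»,
  `n = 0` the p. 92 sup-norm sentence once more (cf. `rProjML_sup_bound_of_inverse`).  Mechanism = B8 p. 92 / [4] p. 399: the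
  (3.49)₀ kernel bound of `P` (`ineq349_multiLevelBox_of_inverse`, entry 1) ⇒ block majorant (§1) ⇒ «using again Lemma 2.1».
* §3 **`ineq1101_multiLevelBox`** (HYPOTHESIS-FREE — only `G′` enters) — for every `n`: `∃ C′, M₀, N₀` such that for every `f` with
  `|f(z)| ≦ S(L^{j(z)})⁻ⁿ` and every fine point `x` at level `j`: `|(G′f)(x)| ≦ C′(Lʲ)²(Lʲ)⁻ⁿS`, `|(∂_μG′f)(x)| ≦ C′Lʲ(Lʲ)⁻ⁿS`,
  `|(G′∂*_μf)(x)| ≦ C′Lʲ(Lʲ)⁻ⁿS`, `|((−Δ^N)G′f)(x)| ≦ C′(Lʲ)⁻ⁿS` — the entries 1, 2, 3, 6 of [B6] (2.67) = [4] (3.42) at U = 1 in the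
  weighted norms of (3.47); **`ineq1101_multiLevelBox_two`** — `n = 2`: «G′ : |·|₍₋₂₎ → |·|», «∇G′ : |·|₍₋₂₎ → |·|₍₋₁₎» = THE PRINTED
  SENTENCE OF (1.101) (+ `G′∇*`, + the Δ-entry `|ΔG′f|₍₋₂₎ ≦ C′|f|₍₋₂₎`).
* §4 **`ineq1101_GR_multiLevelBox_of_inverse`** — the composite letter `G′R` of (1.100)–(1.101): `|(G′Rf)(x)| ≦ C′B′₀S`,
  `|(∂_μG′Rf)(x)| ≦ C′B′₀(Lʲ)⁻¹S` for `|f(z)| ≦ S(L^{j(z)})⁻²` («|G′R𝔉|, |DG′R𝔉|₍₋₁₎ ≦ O(1)B′₀·|𝔉|₍₋₂₎-size»).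
* §5 HYPOTHESIS-FREE twins **`ineq198R_multiLevelBox`**, **`ineq1101_GR_multiLevelBox`**: `∃ G` = THE two-sided inverse of `Q′G′²Q′*`
  (`G·(Q′G′²Q′*) = 1 = (Q′G′²Q′*)·G`, from p21's `prop23_multiLevelBox` pattern `⟨G, h1, h2, -, -, h5, -⟩`) with the bounds of §2/§4.
* §6 IN PRINT'S OWN NORM `|·|₍α₎` of p. 86 = the typed `B8ScaledSupNorm.msup (ℓ+1) k 1 α (Ω_j := {z : j ≤ lev z})` (η = 1): the
  dictionary on the box (`bdd_box` — the `sup` is finite; `pointwise_of_msup_le` / `msup_le_of_pointwise_box` — `|f|₍₋ₙ₎ ≦ S` ⟺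
  `|f(z)| ≦ S(L^{j(z)})⁻ⁿ`, [4] p. 397 «For α negative we can take Ω_j instead of Ω_j∖Ω_{j+1}») and the restatements
  **`ineq198R_multiLevelBox_msup`** (`|Rf|₍₋ₙ₎ ≦ B′₀|f|₍₋ₙ₎`, `|Pf|₍₋ₙ₎ ≦ B′₀|f|₍₋ₙ₎`, hypothesis-free) and **`ineq1101_multiLevelBox_msup`**
  (`|G′f|₍₀₎, |∂_μG′f|₍₋₁₎, |G′∂*_μf|₍₋₁₎, |(−Δ^N)G′f|₍₋₂₎ ≦ C′|f|₍₋₂₎`) — the printed shapes of (1.98) and (1.101) symbol for symbol.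
With this file EVERY [4]-input of B8 Sects. D–E that is built from the SCALAR letters `G′`, `(Q′G′²Q′*)⁻¹`, `H′`, `R` ((1.92) + Δ-entry,
«Q′H′ = I», «|Rf| ≦ B′₀|f|», (1.98) R-half, (1.101), (3.49)) is a theorem at U₀ = 1 on the `k`-level box family; the VECTOR side
((1.57)–(1.59): G(U₀), H(U₀) = [B6] Props 2.6/2.7/Cor. 2.8 at ≥ 2 levels) is not touched (HOME/lit-balaban-r05/B8-CLOSURE.md §3.1(a)).

HONEST SCOPE / NOT CLAIMED.  (i) As `B8Ineq192MultiLevelBox`/`B9Ineq349MultiLevelBox`: Neumann box, levels `1 … k` with `Ω₁ = X`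
(print: `j = 0 … k` on the torus `T_η`, `Ω₀ = T`), background `U₀ = 1` (`A = 0`), scalar fibre (the Lie-algebra index is a spectator at
U₀ = 1), lattice units `η = 1` at the finest level (print's `(Lʲη)` = our `Lʲ` up to the fixed factor `η = L^{−k}` on both sides of each
inequality), `x ∈ Ω_j` read at the point's own level; constants EXISTENTIAL (functions of `d, ℓ`, the weight windows and `n`; print:
«B′₀ is an absolute constant (depending on d and L only)» at the series' fixed `a`), thresholds «M, RM sufficiently large» explicit
and `n`-dependent ([4] p. 398 keeps «α in a compact set»; here one statement per natural exponent `n`).  (ii) The general statements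
at a regular background `U₀ ∈ 𝔄_k` ([4] Thms 3.1–3.3) stay the typed leaves / function-level theorems of `B8Ineq198R`, `B8Ineq192Op`,
`B9Ineq347AllEntries`; rows B8.Claim@92 / B8.Eq1.99 / B8.Eq1.101 heads are NOT changed by this instance (owner's standing word,
B8-CLOSURE §5 item 3).  (iii) The (1.98) V-half is `B8Ineq197.ineq198_local` (local operator, any carrier); (1.99) is the norm
arithmetic `B8Ineq199Assembly`; the abstract normed spaces `F`, `E` of `B8SectDSource` are not instantiated here — §6 states the
bounds for the typed p. 86 norm `msup` on this box (a real-valued `sup`, not a `NormedSpace` structure); packaging the fine functions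
of the box as the Banach spaces of `B8SectDSource` is routine and left to a consumer.  NOT summit progress, NOT continuum, NOT Clay; value = two more named hypotheses of the cell's Sect. D
certification discharged on genuine multi-level carriers at the flat background.

RELATED IN THE TREE, NOT DUPLICATED (searched 2026-08-22T17:50Z: `ls Balaban1983to89/ | grep -i '198\|1101'` = `B8Ineq198R` (function
level), `B5Ineq1101QGQTorus`, `B15Ineq198ConcreteC`, `B16Eq1101Subtraction`, `B16Exp198*` (other papers); `grep -i MultiLevelBox` = the
p21 chain + r05's three files; HOME/STATUS + p21/r03 successor lists: no seat on (1.98)/(1.101) multi-level): `B8Ineq198R.*`,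
`B8Ineq192MultiLevelBox.*`, `B9Ineq349MultiLevelBox.*`, `B6Prop22AllMultiLevelBox.*`, `B6Prop23MultiLevelBox.*`, `B6Geom246MultiLevelBox.*`
(USED BY NAME), `B8SectDSource.*` (the consumer of the two hypotheses; not modified), `B8ScaledSupNorm.*` (the p. 86 norm; not modified).
-/

namespace Literature.MathematicalPhysics.QuantumFieldTheory.Balaban1983to89.B8Ineq198MultiLevelBoxL0

open Finset Matrix
open B4Reflection242 (boxDom)
open B4BoxCov237 (opBoxR)
open B6MultiLevelBoxOperator hiding Domains mlOp_apply
open B6MultiLevelBoxOperatorL0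
open B6Geom246MultiLevelBox hiding Touch blkOf blkOf_corner blkOf_eq_iff_blk blkOf_eq_of_blk_i_eq blkOf_val bond bond_adj bset cen connected coord_bounds corner corner_mem csys dist_blkOf_le_box dist_blkOf_le_coord dist_blkOf_le_line dist_cen_le_of_adj dist_cen_le_of_touch dist_le_one_of_near dist_toR_cen_le exists_blkOf_eq geom lemma21_box lev_corner lev_eq_of_blkOf_eq levelGap pack reachable_blkOf reachable_of_near realizes scale_bounds touch_symm triangle_refl_nonneg walk_disp
open B6Geom246MultiLevelBoxL0
open B6Ineq268MultiLevelBox hiding QB QB_apply QsB QsB_apply W W_eq W_pos Xk abs_qB abs_qB_le card_blkOf_le csysB geomB geomB_L geomB_M geomB_R geomB_RM geomB_RM_nonneg geomB_Site geomB_dist geomB_eta geomB_len geom_len ineq268_multiLevelBox instDecidableEqGeomBSite kerOp_Xk levelSepB qB qB_ne_zero realizesB refl_nonnegB sum_abs_qB_le symmB triangleB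
open B6Ineq268MultiLevelBoxL0
open B6Prop22DerivMultiLevelBox (dMat)
open B6Prop22AllMultiLevelBoxL0 (prop22_entries1236_multiLevelBox)
open B6RandomWalk (HasMajorant BlockSupp hasMajorant_mono)
open B6Ineq261LevelGap (K261 K261_nonneg theta_lt_one_of_log)
open B6Ineq243TwoLevelBox (aNext)
open B6Expansion282 (kerOp)
open B6Prop23Chain (mat)
open B6Prop23MultiLevelBoxL0 (prop23_multiLevelBox)
open B8Ineq192MultiLevelBox (abs_apply_le_of_levelBound levelRowSum_le ineq261With_of_le)
open B8Ineq192MultiLevelBoxL0 (rProjML len_pos len_eq len_blkOf inv_pow_len_le)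
open B9Ineq349MultiLevelBoxL0 (pProjML rProjML_eq_one_sub_pProjML ineq349_multiLevelBox_of_inverse)

noncomputable section

variable {d : ℕ}

/-! ## §1  Engine: block majorant from a (3.49)-shaped kernel bound; a majorant applied to a `(Lʲ)⁻ⁿ`-weighted input -/

section Engine

variable {ℓ Mh k R : ℕ} {P : Fin (d + 1) → ℕ} {D : Domains d ℓ Mh k P R}

/-- a linear map on functions of a finite set, applied: the sum over the unit columns. [folklore] -/
private theorem apply_eq_sum_single {ι Y : Type} [Fintype ι] [DecidableEq ι] (Φ : (ι → ℝ) →ₗ[ℝ] (Y → ℝ)) (X : ι → ℝ)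
    (x : Y) : Φ X x = ∑ y' : ι, Φ (Pi.single y' 1) x * X y' := by
  have hdec : X = ∑ y' : ι, X y' • (Pi.single y' (1 : ℝ) : ι → ℝ) := by
    funext z
    rw [Finset.sum_apply]
    simp [Pi.single_apply]
  conv_lhs => rw [hdec, map_sum, Finset.sum_apply]
  refine Finset.sum_congr rfl fun y' _ => ?_
  rw [map_smul, Pi.smul_apply, smul_eq_mul, mul_comm]

/-- **BLOCK MAJORANT FROM A (3.49)-SHAPED KERNEL BOUND** ((2.51)/(2.55) «|(Tλ)(x)| ≦ K(y, y′)|λ|, supp λ ⊂ B^{j′}(y′)» from a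
pointwise kernel estimate): if the matrix entries of a fine-lattice operator satisfy `|T(x, x′)| ≦ B·W(y(x′))⁻¹·e^{−ρd(y(x),y(x′))}`
(`W(y′) = (L^{j′})^{d+1}`, the number of fine points of the block `B(y′)` being `≦ W(y′)`), then `T` has the block majorant
`K(y, y′) = B·e^{−ρd(y,y′)}` — summing the kernel over the block cancels the printed `(L^{j′}η)^{−d}`.
[cite: Balaban1985BackgroundPropagators, (3.49) p.399, p.391 (kernels); Balaban1984PropagatorsII, (2.51) p.232, (2.55) p.232, (2.69) p.235] -/
theorem hasMajorant_of_kernelBound {T : Module.End ℝ (↥(boxDom (N0 ℓ Mh k P)) → ℝ)} {B ρ : ℝ} (hB : 0 ≤ B)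
    (hker : ∀ x x' : ↥(boxDom (N0 ℓ Mh k P)), |T (Pi.single x' 1) x| ≤
      B * (B6Ineq268MultiLevelBoxL0.W D (blkOf D x'))⁻¹ * Real.exp (-(ρ * (geom D).dist (blkOf D x) (blkOf D x')))) :
    HasMajorant (g := geom D) (blkOf D) T (fun y y' => B * Real.exp (-(ρ * (geom D).dist y y'))) := by
  intro y' u c hu x
  have hW := W_pos D y'
  have hc : 0 ≤ c := hu.nonneg
  set Kc : ℝ := B * (W D y')⁻¹ * Real.exp (-(ρ * (geom D).dist (blkOf D x) y')) * c with hKc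
  have hKc0 : 0 ≤ Kc := by rw [hKc]; positivity
  have hterm : ∀ x' : ↥(boxDom (N0 ℓ Mh k P)), |T (Pi.single x' 1) x * u x'| ≤
      Kc * (if blkOf D x' = y' then (1 : ℝ) else 0) := by
    intro x'
    by_cases h : blkOf D x' = y'
    · rw [if_pos h, mul_one, abs_mul, hKc]
      have h1 := hker x x'
      rw [h] at h1
      exact mul_le_mul h1 (hu.bound x' h) (abs_nonneg _) (by positivity)
    · rw [if_neg h, mul_zero, hu.off x' h, mul_zero, abs_zero]
  have hcard := card_blkOf_le D y'
  rw [apply_eq_sum_single T u x]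
  calc |∑ x' : ↥(boxDom (N0 ℓ Mh k P)), T (Pi.single x' 1) x * u x'|
      ≤ ∑ x' : ↥(boxDom (N0 ℓ Mh k P)), |T (Pi.single x' 1) x * u x'| := Finset.abs_sum_le_sum_abs _ _
    _ ≤ ∑ x' : ↥(boxDom (N0 ℓ Mh k P)), Kc * (if blkOf D x' = y' then (1 : ℝ) else 0) :=
        Finset.sum_le_sum fun x' _ => hterm x'
    _ = Kc * (((Finset.univ.filter fun x : ↥(boxDom (N0 ℓ Mh k P)) => blkOf D x = y').card : ℕ) : ℝ) := by
        rw [← Finset.mul_sum, Finset.sum_boole]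
    _ ≤ Kc * W D y' := mul_le_mul_of_nonneg_left hcard hKc0
    _ = B * Real.exp (-(ρ * (geom D).dist (blkOf D x) y')) * c := by
        rw [hKc]; field_simp

/-- **A BLOCK MAJORANT APPLIED TO A `(Lʲ)⁻ⁿ`-WEIGHTED INPUT** ([4] p. 398: «Using Lemma 2.1 in [4] we may replace the factor (Lʲη)^α by
(Lʲη)^β(L^{j′}η)^γ with β + γ = α»; B8 p. 92 «The operators R and V are bounded in this norm»): if `T` has the majorant
`C·p(y)·e^{−σd(y,y′)}` (`C, p ≥ 0`), the input satisfies `|u(z)| ≦ A·(L^{j(z)})⁻ⁿ`, the row sums at the rate `τ` are `≦ c`,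
`τ + β ≦ σ`, `β ≥ 0` and `Lⁿ ≦ e^{β(RM−1)}` ((2.60) threshold), then `|(Tu)(x)| ≦ A·C·p(y(x))·(Lⁿc)·(L^{j(x)})⁻ⁿ`.
[cite: Balaban1985BackgroundPropagators, (3.47) p.398, (3.41) p.397; Balaban1985RegularSpaces, (1.98) p.92; Balaban1984PropagatorsII, Lemma 2.1 (2.60)–(2.61) p.234, (2.52)–(2.55) p.232] -/
theorem apply_le_of_invPow (hMh : 1 ≤ Mh) (hP : ∀ μ, 1 ≤ P μ) (hRM : 1 ≤ R * ((ℓ + 1) * Mh))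
    {T : Module.End ℝ (↥(boxDom (N0 ℓ Mh k P)) → ℝ)} {C σ β τ c : ℝ} (hC : 0 ≤ C) (hβ : 0 ≤ β) (hτβ : τ + β ≤ σ)
    {p : ↥(B6Geom246MultiLevelBoxL0.bset D) → ℝ} (hp : ∀ y, 0 ≤ p y)
    (hT : HasMajorant (g := geom D) (blkOf D) T (fun y y' => C * p y * Real.exp (-(σ * (geom D).dist y y'))))
    (h261 : ∀ y : (geom D).Site, ∑ y'' : (geom D).Site, Real.exp (-(τ * (geom D).dist y y'')) ≤ c)
    (n : ℕ) (hthr : ((ℓ : ℝ) + 1) ^ n ≤ Real.exp (β * ((geomB D).R * (geomB D).M)))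
    {u : ↥(boxDom (N0 ℓ Mh k P)) → ℝ} {A : ℝ} (hA : 0 ≤ A)
    (hu : ∀ z, |u z| ≤ A * ((geom D).len (blkOf D z) ^ n)⁻¹) (x : ↥(boxDom (N0 ℓ Mh k P))) :
    |T u x| ≤ A * C * p (blkOf D x) * (((ℓ : ℝ) + 1) ^ n * c) * ((geom D).len (blkOf D x) ^ n)⁻¹ := by
  have hdnn := (triangle_refl_nonneg D hMh hP).2.2
  have hlen0 : ∀ y : ↥(bset D), 0 ≤ (geom D).len y := fun y => (len_pos D y).le
  have h1 := abs_apply_le_of_levelBound (g := geom D) (blkOf D) hT (p := fun b => ((geom D).len b ^ n)⁻¹) hA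
    (fun b => inv_nonneg.2 (pow_nonneg (hlen0 b) n)) hu x
  have hf : ∀ y y'' : (geom D).Site, ((geom D).len y'' ^ n)⁻¹ ≤
      ((ℓ : ℝ) + 1) ^ n * Real.exp (β * (geom D).dist y y'') * ((geom D).len y ^ n)⁻¹ :=
    fun y y'' => inv_pow_len_le hMh hP hRM n hβ hthr y y''
  have h2 := levelRowSum_le (g := geom D) hdnn (σ := σ) (β := β) (τ := τ) (A := ((ℓ : ℝ) + 1) ^ n) (c := c)
    hτβ (by positivity) (f := fun b => ((geom D).len b ^ n)⁻¹) (fun b => inv_nonneg.2 (pow_nonneg (hlen0 b) n))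
    hf h261 (blkOf D x)
  refine h1.trans ?_
  have hsum : ∑ b' : (geom D).Site, C * p (blkOf D x) * Real.exp (-(σ * (geom D).dist (blkOf D x) b')) *
        ((geom D).len b' ^ n)⁻¹ = C * p (blkOf D x) * ∑ b' : (geom D).Site,
          Real.exp (-(σ * (geom D).dist (blkOf D x) b')) * ((geom D).len b' ^ n)⁻¹ := by
    rw [Finset.mul_sum]
    exact Finset.sum_congr rfl fun b' _ => by ring
  rw [hsum]
  have hCp : 0 ≤ C * p (blkOf D x) := mul_nonneg hC (hp _)
  calc A * (C * p (blkOf D x) * ∑ b' : (geom D).Site,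
          Real.exp (-(σ * (geom D).dist (blkOf D x) b')) * ((geom D).len b' ^ n)⁻¹)
      ≤ A * (C * p (blkOf D x) * (((ℓ : ℝ) + 1) ^ n * c * ((geom D).len (blkOf D x) ^ n)⁻¹)) :=
        mul_le_mul_of_nonneg_left (mul_le_mul_of_nonneg_left h2 hCp) hA
    _ = A * C * p (blkOf D x) * (((ℓ : ℝ) + 1) ^ n * c) * ((geom D).len (blkOf D x) ^ n)⁻¹ := by ring

/-- the `n`-dependent (2.59)-type threshold: for `N₁ = ⌈(2(d+1) + n + 1)·L/σ⌉ + 1` one has `(2(d+1) + n + 1)·L < σN₁`. [folklore] -/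
private theorem threshold_gt {σ : ℝ} (hσ : 0 < σ) (d ℓ n : ℕ) {N₁ : ℕ}
    (hN₁ : N₁ = ⌈(2 * ((d : ℝ) + 1) + n + 1) * ((ℓ : ℝ) + 1) / σ⌉₊ + 1) :
    (2 * ((d : ℝ) + 1) + n + 1) * ((ℓ : ℝ) + 1) < σ * (N₁ : ℝ) := by
  have h : (2 * ((d : ℝ) + 1) + n + 1) * ((ℓ : ℝ) + 1) / σ < (N₁ : ℝ) := by
    rw [hN₁]; push_cast
    exact lt_of_le_of_lt (Nat.le_ceil _) (by linarith)
  rw [div_lt_iff₀ hσ] at h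
  linarith

/-- **LEMMA 2.1 AND THE SCALE ABSORPTION ON THE BOX AT A GIVEN RATE** (the two uses of «RM sufficiently large» behind «using
again Lemma 2.1», made explicit): for `σ > 0` and `N₁ = ⌈(2(d+1) + n + 1)L/σ⌉ + 1`, if `R·L·M_h ≥ N₁ + 1` then the row sums
`Σ_{y′}e^{−τd(y,y′)}` are `≦ K261(N₁, d+1, L, 1, σ)` for every `τ ≥ σ` ((2.61)) and `Lⁿ ≦ e^{σ(RM−1)}` ((2.60) threshold).
[cite: Balaban1984PropagatorsII, Lemma 2.1 (2.59)–(2.61) pp.233–234, (2.2) p.224] -/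
theorem rowSum_and_threshold (hMh : 1 ≤ Mh) (hP : ∀ μ, 1 ≤ P μ) {σ : ℝ} (hσ : 0 < σ) (n : ℕ) {N₁ : ℕ}
    (hN₁ : N₁ = ⌈(2 * ((d : ℝ) + 1) + n + 1) * ((ℓ : ℝ) + 1) / σ⌉₊ + 1) (hRM : N₁ + 1 ≤ R * ((ℓ + 1) * Mh)) :
    (∀ τ : ℝ, σ ≤ τ → ∀ y : (B6Geom246MultiLevelBoxL0.geom D).Site,
        ∑ y'' : (geom D).Site, Real.exp (-(τ * (geom D).dist y y'')) ≤ K261 N₁ (d + 1) ((ℓ : ℝ) + 1) 1 (1 * σ)) ∧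
      ((ℓ : ℝ) + 1) ^ n ≤ Real.exp (σ * ((geomB D).R * (geomB D).M)) := by
  have hL0 : (0 : ℝ) < (ℓ : ℝ) + 1 := by positivity
  have hL1 : (1 : ℝ) ≤ (ℓ : ℝ) + 1 := by linarith [(Nat.cast_nonneg ℓ : (0 : ℝ) ≤ ℓ)]
  have hlog : Real.log ((ℓ : ℝ) + 1) ≤ (ℓ : ℝ) + 1 := (Real.log_le_sub_one_of_pos hL0).trans (by linarith)
  have hlog0 : 0 ≤ Real.log ((ℓ : ℝ) + 1) := Real.log_nonneg hL1
  have hN₁pos : 0 < N₁ := by rw [hN₁]; omega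
  have hgt := threshold_gt hσ d ℓ n hN₁
  have hdnn := (triangle_refl_nonneg D hMh hP).2.2
  have hd0 : (0 : ℝ) ≤ (d : ℝ) := Nat.cast_nonneg d
  have hn0 : (0 : ℝ) ≤ (n : ℝ) := Nat.cast_nonneg n
  refine ⟨?_, ?_⟩
  · -- (2.61) at the rate `σ` via `lemma21_box` (α = 1, δ₀ := σ), then monotonicity in the rate
    have hθ : Real.exp (-(1 * σ)) * ((ℓ : ℝ) + 1) ^ ((2 * (d + 1 : ℕ) : ℝ) / N₁) < 1 := by
      refine theta_lt_one_of_log hL0 hN₁pos ?_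
      push_cast
      nlinarith [mul_le_mul_of_nonneg_left hlog (by positivity : (0 : ℝ) ≤ 2 * ((d : ℝ) + 1))]
    obtain ⟨-, h261, -, -⟩ := lemma21_box D hMh hP hN₁pos hRM hσ.le (α := 1) zero_le_one le_rfl hθ
    intro τ hτ y
    have h := ineq261With_of_le (g := geom D) h261 (δ' := τ) (α' := 1) (by linarith) hdnn y
    simpa only [one_mul] using h
  · -- `n·log L ≤ n·L ≤ σN₁ ≤ σ(R·L·M_h − 1)`
    rw [geomB_RM D hMh]
    have hge : (N₁ : ℝ) ≤ (R : ℝ) * (((ℓ : ℝ) + 1) * Mh) - 1 := by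
      have : ((N₁ + 1 : ℕ) : ℝ) ≤ ((R * ((ℓ + 1) * Mh) : ℕ) : ℝ) := by exact_mod_cast hRM
      push_cast at this; linarith
    have hnl : (n : ℝ) * Real.log ((ℓ : ℝ) + 1) ≤ σ * ((R : ℝ) * (((ℓ : ℝ) + 1) * Mh) - 1) := by
      have h1 : σ * (N₁ : ℝ) ≤ σ * ((R : ℝ) * (((ℓ : ℝ) + 1) * Mh) - 1) := mul_le_mul_of_nonneg_left hge hσ.le
      nlinarith [mul_le_mul_of_nonneg_left hlog hn0]
    calc ((ℓ : ℝ) + 1) ^ n = Real.exp ((n : ℝ) * Real.log ((ℓ : ℝ) + 1)) := by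
          rw [← Real.exp_log (pow_pos hL0 n), Real.log_pow]
      _ ≤ _ := Real.exp_le_exp.2 hnl

end Engine

/-! ## §2  (1.98), R-half, at U₀ = 1 on the `k`-level box family: «|Rf|₍₋ₙ₎ ≦ B′₀|f|₍₋ₙ₎», `G` standing for `(Q′G′²Q′*)⁻¹` -/

section R198

/-- **(1.98), R-HALF, AT U₀ = 1 ON THE `k`-LEVEL NEUMANN-BOX FAMILY, THE INVERSE ENTERING BY ITS (2.87)-BOUND** («The operators R
and V are bounded in this norm, and we have |Rf|₍₋₂₎ ≦ B′₀|f|₍₋₂₎», here for every natural exponent `n`): for every `n` and every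
`C₁, δ₁ > 0` there are `B′₀, M₀ > 0`, `N₀ ≥ 1` (functions of `d, ℓ`, the weight windows, `C₁, δ₁, n`) such that for every number of
levels `k`, every `M_h ≥ 3` with `L·M_h ≥ M₀`, every `R ≥ 2L` with `R·L·M_h ≥ N₀ + 1`, every box `P`, every nested family `D` of
block-union domains with (2.1)–(2.2), every weight sequence in the windows with `a_{i+1} = aNext ℓ a_i c_i`, EVERY operator `G` on `𝔅`
with `|G(y, y′)| ≦ C₁(Lʲ)⁻⁴(L^{j′})^{−(d+1)}e^{−½δ₁d(y,y′)}` (the printed bound (2.87) of [B6] Prop. 2.3 for `(Q′G′²Q′*)⁻¹`, (2.69)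
convention), every fine function `f` with `|f(z)| ≦ S·(L^{j(z)})⁻ⁿ` (`j(z) = D.lev z`, i.e. `|f|₍₋ₙ₎ ≦ S`) and every fine point `x`:
`|(Pf)(x)| ≦ B′₀(L^{j(x)})⁻ⁿS` and **`|(Rf)(x)| ≦ B′₀(L^{j(x)})⁻ⁿS`** for `P = G′Q′*GQ′G′` (`pProjML`) and `R = 1 − P` (`rProjML`, [4]
(3.25) = B8 (1.27) at the flat background).  Mechanism (p. 92 «from Theorems 3.1, 3.2 of [4]» / [4] p. 399 «using again Lemma
2.1»): the (3.49)₀ kernel bound of `P` (`ineq349_multiLevelBox_of_inverse`) ⇒ block majorant `Be^{−ρd}` (§1) ⇒ the weight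
`(L^{j′})⁻ⁿ` moved to `x` by (2.60) and the row summed by (2.61) (§1 `apply_le_of_invPow`).
[cite: Balaban1985RegularSpaces, (1.98) p.92, p.92 l.17–18, (1.27) p.80; Balaban1985BackgroundPropagators, (3.49) p.399, (3.47) p.398, (3.41) p.397, (3.25) p.394; Balaban1984PropagatorsII, Prop. 2.3 (2.87) p.238, Lemma 2.1 (2.60)–(2.61) p.234] -/
theorem ineq198R_multiLevelBox_of_inverse (d ℓ : ℕ) (hℓ : 1 ≤ ℓ) (aminus aplus a2minus a2plus : ℝ) (ha : 0 < aminus)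
    (ha2 : 0 < a2minus) {C₁ δ₁ : ℝ} (hC₁ : 0 < C₁) (hδ₁ : 0 < δ₁) (n : ℕ) :
    ∃ B₀' M₀ : ℝ, ∃ N₀ : ℕ, 0 < B₀' ∧ 0 < M₀ ∧ 0 < N₀ ∧
      ∀ (k Mh R : ℕ), 3 ≤ Mh → M₀ ≤ ((ℓ : ℝ) + 1) * Mh → 2 * (ℓ + 1) ≤ R → N₀ + 1 ≤ R * ((ℓ + 1) * Mh) →
      ∀ (P : Fin (d + 1) → ℕ) (_hP : ∀ μ, 1 ≤ P μ) (D : Domains d ℓ Mh k P R) (a c : ℕ → ℝ),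
        (∀ i, aminus ≤ a i ∧ a i ≤ aplus) → (∀ i, a2minus ≤ c i ∧ c i ≤ a2plus) →
        (∀ i, a (i + 1) = aNext ℓ (a i) (c i)) →
        ∀ G : Module.End ℝ (↥(bset D) → ℝ),
          (∀ y y' : ↥(bset D), |mat G y y' / W D y'| ≤
            C₁ * (geom D).len y ^ (-(4 : ℝ)) * (geom D).len y' ^ (-((d + 1 : ℕ) : ℝ)) *
              Real.exp (-(δ₁ / 2 * (geom D).dist y y'))) →
          ∀ (f : ↥(boxDom (N0 ℓ Mh k P)) → ℝ) (S : ℝ), 0 ≤ S →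
            (∀ z : ↥(boxDom (N0 ℓ Mh k P)), |f z| ≤ S * ((((ℓ : ℝ) + 1) ^ D.lev z.1) ^ n)⁻¹) →
            ∀ x : ↥(boxDom (N0 ℓ Mh k P)),
              |pProjML D a G f x| ≤ B₀' * ((((ℓ : ℝ) + 1) ^ D.lev x.1) ^ n)⁻¹ * S ∧
              |rProjML D a G f x| ≤ B₀' * ((((ℓ : ℝ) + 1) ^ D.lev x.1) ^ n)⁻¹ * S := by
  obtain ⟨ρ, B, M₀, N₀, hρ, hB, hM₀, hN₀, h349⟩ :=
    ineq349_multiLevelBox_of_inverse d ℓ hℓ aminus aplus a2minus a2plus ha ha2 hC₁ hδ₁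
  have hL0 : (0 : ℝ) < (ℓ : ℝ) + 1 := by positivity
  -- Lemma 2.1 / absorption at the rate `ρ/2`
  obtain ⟨σ, hσ⟩ : ∃ σ : ℝ, σ = ρ / 2 := ⟨_, rfl⟩
  have hσ0 : 0 < σ := by rw [hσ]; positivity
  obtain ⟨N₁, hN₁⟩ : ∃ N₁ : ℕ, N₁ = ⌈(2 * ((d : ℝ) + 1) + n + 1) * ((ℓ : ℝ) + 1) / σ⌉₊ + 1 := ⟨_, rfl⟩
  obtain ⟨cK, hcK⟩ : ∃ cK : ℝ, cK = K261 N₁ (d + 1) ((ℓ : ℝ) + 1) 1 (1 * σ) := ⟨_, rfl⟩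
  have hcK0 : 0 ≤ cK := by rw [hcK]; exact K261_nonneg hL0.le zero_le_one
  obtain ⟨Bp, hBp⟩ : ∃ Bp : ℝ, Bp = B * (((ℓ : ℝ) + 1) ^ n * cK) := ⟨_, rfl⟩
  have hBp0 : 0 ≤ Bp := by rw [hBp]; positivity
  refine ⟨Bp + 1, M₀, max N₀ N₁, by linarith, hM₀, lt_of_lt_of_le hN₀ (le_max_left _ _), ?_⟩
  intro k Mh R hMh hM hR hRM P hP D a c haw hcw hac G hG f S hS hf x
  have hMh1 : 1 ≤ Mh := le_trans (by norm_num) hMh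
  have hRM0 : N₀ + 1 ≤ R * ((ℓ + 1) * Mh) := le_trans (Nat.succ_le_succ (le_max_left _ _)) hRM
  have hRM1 : N₁ + 1 ≤ R * ((ℓ + 1) * Mh) := le_trans (Nat.succ_le_succ (le_max_right _ _)) hRM
  have hRMone : 1 ≤ R * ((ℓ + 1) * Mh) := le_trans (by omega) hRM1
  obtain ⟨hrow, hthr⟩ := rowSum_and_threshold (D := D) hMh1 hP hσ0 n hN₁ hRM1
  rw [← hcK] at hrow
  -- the block majorant of `P` from the (3.49)₀ kernel bound
  have hker : ∀ x x' : ↥(boxDom (N0 ℓ Mh k P)), |pProjML D a G (Pi.single x' 1) x| ≤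
      B * (W D (blkOf D x'))⁻¹ * Real.exp (-(ρ * (geom D).dist (blkOf D x) (blkOf D x'))) :=
    fun x x' => (h349 k Mh R hMh hM hR hRM0 P hP D a c haw hcw hac G hG x x').1
  have hmaj : HasMajorant (g := geom D) (blkOf D) (pProjML D a G)
      (fun y y' => B * (1 : ℝ) * Real.exp (-(ρ * (geom D).dist y y'))) := by
    refine hasMajorant_mono (g := geom D) (blkOf D) (hasMajorant_of_kernelBound hB.le hker) fun y y' => le_of_eq ?_
    rw [mul_one]
  -- the input in the engine's letters
  have hu : ∀ z : ↥(boxDom (N0 ℓ Mh k P)), |f z| ≤ S * ((geom D).len (blkOf D z) ^ n)⁻¹ := fun z => by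
    rw [len_blkOf]; exact hf z
  have hPf := apply_le_of_invPow (D := D) hMh1 hP hRMone (σ := ρ) (β := σ) (τ := σ) (c := cK) hB.le hσ0.le
    (by rw [hσ]; linarith) (p := fun _ => (1 : ℝ)) (fun _ => zero_le_one) hmaj (hrow σ le_rfl) n hthr hS hu x
  rw [len_blkOf, mul_one] at hPf
  -- `|Pf(x)| ≤ Bp·λ⁻ⁿ·S`
  have hlam : 0 < (((ℓ : ℝ) + 1) ^ D.lev x.1) ^ n := pow_pos (pow_pos hL0 _) _
  have hPf' : |pProjML D a G f x| ≤ Bp * ((((ℓ : ℝ) + 1) ^ D.lev x.1) ^ n)⁻¹ * S := by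
    refine hPf.trans (le_of_eq ?_)
    rw [hBp]; ring
  have hw0 : 0 ≤ ((((ℓ : ℝ) + 1) ^ D.lev x.1) ^ n)⁻¹ * S := mul_nonneg (inv_nonneg.2 hlam.le) hS
  refine ⟨?_, ?_⟩
  · calc |pProjML D a G f x| ≤ Bp * ((((ℓ : ℝ) + 1) ^ D.lev x.1) ^ n)⁻¹ * S := hPf'
      _ ≤ (Bp + 1) * ((((ℓ : ℝ) + 1) ^ D.lev x.1) ^ n)⁻¹ * S := by
          rw [mul_assoc, mul_assoc]; exact mul_le_mul_of_nonneg_right (by linarith) hw0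
  · -- `Rf = f − Pf`
    have e : rProjML D a G f x = f x - pProjML D a G f x := by
      rw [rProjML_eq_one_sub_pProjML, LinearMap.sub_apply, Module.End.one_apply, Pi.sub_apply]
    rw [e]
    calc |f x - pProjML D a G f x| ≤ |f x| + |pProjML D a G f x| := abs_sub _ _
      _ ≤ S * ((((ℓ : ℝ) + 1) ^ D.lev x.1) ^ n)⁻¹ + Bp * ((((ℓ : ℝ) + 1) ^ D.lev x.1) ^ n)⁻¹ * S :=
          add_le_add (hf x) hPf'
      _ = (Bp + 1) * ((((ℓ : ℝ) + 1) ^ D.lev x.1) ^ n)⁻¹ * S := by ring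

end R198

/-! ## §3  (1.101) / [4] (3.47) at U = 1 on the `k`-level box family: `G′` on `(Lʲ)⁻ⁿ`-weighted inputs (hypothesis-free) -/

section G1101

/-- **[4] THEOREM 3.1 IN THE WEIGHTED NORMS (3.47) AT U = 1 ON THE `k`-LEVEL NEUMANN-BOX FAMILY — the four entries 1, 2, 3, 6 of
(3.42) = [B6] (2.67) for the GENUINE `G′ = Δ′_a⁻¹`, applied to a `(Lʲ)⁻ⁿ`-weighted input** (B8 p. 93: «G′ is a bounded operator from a
space with the norm |·|₍₋₂₎ into a space with the norm |·| for functions, and the norm |·|₍₋₁₎ for their first derivatives», here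
for every natural exponent `n`): for every `n` there are `C′, M₀ > 0`, `N₀ ≥ 1` (functions of `d, ℓ`, the weight windows, `n`) such
that on every member of the family (thresholds as in §2), for every fine function `f` with `|f(z)| ≦ S(L^{j(z)})⁻ⁿ` and every fine
point `x` at level `j`: `|(G′f)(x)| ≦ C′(Lʲ)²(Lʲ)⁻ⁿS`, `|(∂_μG′f)(x)| ≦ C′Lʲ(Lʲ)⁻ⁿS` (every axis), `|(G′∂*_μf)(x)| ≦ C′Lʲ(Lʲ)⁻ⁿS`
(every axis), `|((−Δ^N)G′f)(x)| ≦ C′(Lʲ)⁻ⁿS`.  Mechanism ([4] p. 398 «Using Lemma 2.1 in [4] we may replace the factor (Lʲη)^α by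
(Lʲη)^β(L^{j′}η)^γ»): p21's Prop.-2.2 block majorants `C(Lʲ)^{[2,1,1,0]}e^{−½δ₀d}` (`prop22_entries1236_multiLevelBox`) applied to the
weighted input by §1 `apply_le_of_invPow` ((2.60) moves `(L^{j′})⁻ⁿ` to `x`, (2.61) sums the row).
[cite: Balaban1985RegularSpaces, (1.101) p.93; Balaban1985BackgroundPropagators, Theorem 3.1 (3.42) p.397, (3.47) p.398, (3.41) p.397; Balaban1984PropagatorsII, Prop. 2.2 (2.67) p.234, Lemma 2.1 (2.60)–(2.61) p.234, (2.52)–(2.55) p.232] -/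
theorem ineq1101_multiLevelBox (d ℓ : ℕ) (hℓ : 1 ≤ ℓ) (aminus aplus a2minus a2plus : ℝ) (ha : 0 < aminus)
    (ha2 : 0 < a2minus) (n : ℕ) :
    ∃ C' M₀ : ℝ, ∃ N₀ : ℕ, 0 < C' ∧ 0 < M₀ ∧ 0 < N₀ ∧
      ∀ (k Mh R : ℕ), 3 ≤ Mh → M₀ ≤ ((ℓ : ℝ) + 1) * Mh → 2 * (ℓ + 1) ≤ R → N₀ + 1 ≤ R * ((ℓ + 1) * Mh) →
      ∀ (P : Fin (d + 1) → ℕ) (_hP : ∀ μ, 1 ≤ P μ) (D : Domains d ℓ Mh k P R) (a c : ℕ → ℝ),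
        (∀ i, aminus ≤ a i ∧ a i ≤ aplus) → (∀ i, a2minus ≤ c i ∧ c i ≤ a2plus) →
        (∀ i, a (i + 1) = aNext ℓ (a i) (c i)) →
        ∀ (f : ↥(boxDom (N0 ℓ Mh k P)) → ℝ) (S : ℝ), 0 ≤ S →
          (∀ z : ↥(boxDom (N0 ℓ Mh k P)), |f z| ≤ S * ((((ℓ : ℝ) + 1) ^ D.lev z.1) ^ n)⁻¹) →
          ∀ x : ↥(boxDom (N0 ℓ Mh k P)),
            |(gml (N0 ℓ Mh k P) ℓ k D.lev a *ᵥ f) x| ≤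
              C' * (((ℓ : ℝ) + 1) ^ D.lev x.1) ^ 2 * ((((ℓ : ℝ) + 1) ^ D.lev x.1) ^ n)⁻¹ * S ∧
            (∀ μ : Fin (d + 1), |(dMat (N0 ℓ Mh k P) μ *ᵥ (gml (N0 ℓ Mh k P) ℓ k D.lev a *ᵥ f)) x| ≤
              C' * ((ℓ : ℝ) + 1) ^ D.lev x.1 * ((((ℓ : ℝ) + 1) ^ D.lev x.1) ^ n)⁻¹ * S) ∧
            (∀ μ : Fin (d + 1), |(gml (N0 ℓ Mh k P) ℓ k D.lev a *ᵥ ((dMat (N0 ℓ Mh k P) μ)ᵀ *ᵥ f)) x| ≤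
              C' * ((ℓ : ℝ) + 1) ^ D.lev x.1 * ((((ℓ : ℝ) + 1) ^ D.lev x.1) ^ n)⁻¹ * S) ∧
            |(opBoxR 1 0 0 1 (N0 ℓ Mh k P) *ᵥ (gml (N0 ℓ Mh k P) ℓ k D.lev a *ᵥ f)) x| ≤
              C' * ((((ℓ : ℝ) + 1) ^ D.lev x.1) ^ n)⁻¹ * S := by
  obtain ⟨δ₀, C, M₀, N₀, hδ₀, hC, hM₀, hN₀, h22⟩ :=
    prop22_entries1236_multiLevelBox d ℓ hℓ aminus aplus a2minus a2plus ha ha2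
  have hL0 : (0 : ℝ) < (ℓ : ℝ) + 1 := by positivity
  -- Lemma 2.1 / absorption at the rate `δ₀/4` (majorant rate `δ₀/2 = δ₀/4 + δ₀/4`)
  obtain ⟨σ, hσ⟩ : ∃ σ : ℝ, σ = δ₀ / 4 := ⟨_, rfl⟩
  have hσ0 : 0 < σ := by rw [hσ]; positivity
  obtain ⟨N₁, hN₁⟩ : ∃ N₁ : ℕ, N₁ = ⌈(2 * ((d : ℝ) + 1) + n + 1) * ((ℓ : ℝ) + 1) / σ⌉₊ + 1 := ⟨_, rfl⟩
  obtain ⟨cK, hcK⟩ : ∃ cK : ℝ, cK = K261 N₁ (d + 1) ((ℓ : ℝ) + 1) 1 (1 * σ) := ⟨_, rfl⟩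
  have hcK0 : 0 ≤ cK := by rw [hcK]; exact K261_nonneg hL0.le zero_le_one
  obtain ⟨Cp, hCp⟩ : ∃ Cp : ℝ, Cp = C * (((ℓ : ℝ) + 1) ^ n * cK) := ⟨_, rfl⟩
  have hCp0 : 0 ≤ Cp := by rw [hCp]; positivity
  refine ⟨Cp + 1, M₀, max N₀ N₁, by linarith, hM₀, lt_of_lt_of_le hN₀ (le_max_left _ _), ?_⟩
  intro k Mh R hMh hM hR hRM P hP D a c haw hcw hac f S hS hf x
  have hMh1 : 1 ≤ Mh := le_trans (by norm_num) hMh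
  have hRM0 : N₀ + 1 ≤ R * ((ℓ + 1) * Mh) := le_trans (Nat.succ_le_succ (le_max_left _ _)) hRM
  have hRM1 : N₁ + 1 ≤ R * ((ℓ + 1) * Mh) := le_trans (Nat.succ_le_succ (le_max_right _ _)) hRM
  have hRMone : 1 ≤ R * ((ℓ + 1) * Mh) := le_trans (by omega) hRM1
  obtain ⟨hrow, hthr⟩ := rowSum_and_threshold (D := D) hMh1 hP hσ0 n hN₁ hRM1
  rw [← hcK] at hrow
  obtain ⟨hTG, hTD, hTA, hTL⟩ := h22 k Mh R hMh hM hR hRM0 P hP D a c haw hcw hac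
  have hlen0 : ∀ y : ↥(bset D), 0 ≤ (geom D).len y := fun y => (len_pos D y).le
  -- the Prop.-2.2 majorants with the lengths `(geom D).len`
  have hTG' : HasMajorant (g := geom D) (blkOf D) (Matrix.toLin' (gml (N0 ℓ Mh k P) ℓ k D.lev a))
      (fun y y' => C * (geom D).len y ^ 2 * Real.exp (-(δ₀ / 2 * (geom D).dist y y'))) := by
    refine hasMajorant_mono (g := geom D) (blkOf D) hTG fun y y' => le_of_eq ?_
    rw [len_eq, ← pow_mul, Nat.mul_comm]
  have hTD' : ∀ μ : Fin (d + 1), HasMajorant (g := geom D) (blkOf D)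
      (Matrix.toLin' (dMat (N0 ℓ Mh k P) μ * gml (N0 ℓ Mh k P) ℓ k D.lev a))
      (fun y y' => C * (geom D).len y * Real.exp (-(δ₀ / 2 * (geom D).dist y y'))) := by
    intro μ
    refine hasMajorant_mono (g := geom D) (blkOf D) (hTD μ) fun y y' => le_of_eq ?_
    rw [len_eq]
  have hTA' : ∀ μ : Fin (d + 1), HasMajorant (g := geom D) (blkOf D)
      (Matrix.toLin' (gml (N0 ℓ Mh k P) ℓ k D.lev a * (dMat (N0 ℓ Mh k P) μ)ᵀ))
      (fun y y' => C * (geom D).len y * Real.exp (-(δ₀ / 2 * (geom D).dist y y'))) := by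
    intro μ
    refine hasMajorant_mono (g := geom D) (blkOf D) (hTA μ) fun y y' => le_of_eq ?_
    rw [len_eq]
  have hTL' : HasMajorant (g := geom D) (blkOf D)
      (Matrix.toLin' (opBoxR 1 0 0 1 (N0 ℓ Mh k P) * gml (N0 ℓ Mh k P) ℓ k D.lev a))
      (fun y y' => C * (1 : ℝ) * Real.exp (-(δ₀ / 2 * (geom D).dist y y'))) := by
    refine hasMajorant_mono (g := geom D) (blkOf D) hTL fun y y' => le_of_eq ?_
    rw [mul_one]
  -- the input in the engine's letters
  have hu : ∀ z : ↥(boxDom (N0 ℓ Mh k P)), |f z| ≤ S * ((geom D).len (blkOf D z) ^ n)⁻¹ := fun z => by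
    rw [len_blkOf]; exact hf z
  have hrate : σ + σ ≤ δ₀ / 2 := by rw [hσ]; linarith
  have key : ∀ {T : Module.End ℝ (↥(boxDom (N0 ℓ Mh k P)) → ℝ)} {p : ↥(bset D) → ℝ}, (∀ y, 0 ≤ p y) →
      HasMajorant (g := geom D) (blkOf D) T (fun y y' => C * p y * Real.exp (-(δ₀ / 2 * (geom D).dist y y'))) →
      |T f x| ≤ Cp * p (blkOf D x) * ((((ℓ : ℝ) + 1) ^ D.lev x.1) ^ n)⁻¹ * S := by
    intro T p hp hT
    have h := apply_le_of_invPow (D := D) hMh1 hP hRMone (σ := δ₀ / 2) (β := σ) (τ := σ) (c := cK) hC.le hσ0.le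
      hrate hp hT (hrow σ le_rfl) n hthr hS hu x
    rw [len_blkOf] at h
    refine h.trans (le_of_eq ?_)
    rw [hCp]; ring
  have hlamp : 0 < ((ℓ : ℝ) + 1) ^ D.lev x.1 := pow_pos hL0 _
  have hlam : 0 < (((ℓ : ℝ) + 1) ^ D.lev x.1) ^ n := pow_pos hlamp _
  have hw0 : 0 ≤ ((((ℓ : ℝ) + 1) ^ D.lev x.1) ^ n)⁻¹ * S := mul_nonneg (inv_nonneg.2 hlam.le) hS
  have hlx : (geom D).len (blkOf D x) = ((ℓ : ℝ) + 1) ^ D.lev x.1 := len_blkOf D x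
  -- the weakening `Cp ≤ Cp + 1` against a non-negative product
  have hweak : ∀ {q : ℝ}, 0 ≤ q → ∀ {v : ℝ}, v ≤ Cp * q * ((((ℓ : ℝ) + 1) ^ D.lev x.1) ^ n)⁻¹ * S →
      v ≤ (Cp + 1) * q * ((((ℓ : ℝ) + 1) ^ D.lev x.1) ^ n)⁻¹ * S := by
    intro q hq v hv
    refine hv.trans ?_
    have h0 : 0 ≤ q * (((((ℓ : ℝ) + 1) ^ D.lev x.1) ^ n)⁻¹ * S) := mul_nonneg hq hw0
    nlinarith
  refine ⟨?_, fun μ => ?_, fun μ => ?_, ?_⟩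
  · have h := key (p := fun y => (geom D).len y ^ 2) (fun y => pow_nonneg (hlen0 y) 2) hTG'
    rw [Matrix.toLin'_apply, hlx] at h
    exact hweak (pow_nonneg hlamp.le 2) h
  · have h := key (p := fun y => (geom D).len y) hlen0 (hTD' μ)
    rw [Matrix.toLin'_apply, ← Matrix.mulVec_mulVec, hlx] at h
    exact hweak hlamp.le h
  · have h := key (p := fun y => (geom D).len y) hlen0 (hTA' μ)
    rw [Matrix.toLin'_apply, ← Matrix.mulVec_mulVec, hlx] at h
    exact hweak hlamp.le h
  · have h := key (p := fun _ => (1 : ℝ)) (fun _ => zero_le_one) hTL'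
    rw [Matrix.toLin'_apply, ← Matrix.mulVec_mulVec] at h
    have h' := hweak zero_le_one h
    rw [mul_one] at h'
    exact h'

/-- **THE PRINTED SENTENCE OF (1.101), `n = 2`**: «G′ is a bounded operator from a space with the norm |·|₍₋₂₎ into a space with the norm
|·| for functions, and the norm |·|₍₋₁₎ for their first derivatives» — at U₀ = 1 on the `k`-level box family, for the GENUINE `G′`:
if `|f(z)| ≦ S(L^{j(z)})⁻²` then `|(G′f)(x)| ≦ C′S`, `|(∂_μG′f)(x)| ≦ C′(Lʲ)⁻¹S`, `|(G′∂*_μf)(x)| ≦ C′(Lʲ)⁻¹S`, `|((−Δ^N)G′f)(x)| ≦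
C′(Lʲ)⁻²S` (`j` the level of `x`); `C′` depends on `d, ℓ` and the weight windows only.
[cite: Balaban1985RegularSpaces, (1.101) p.93; Balaban1985BackgroundPropagators, Theorem 3.1 (3.42) p.397, (3.47) p.398; Balaban1984PropagatorsII, Prop. 2.2 (2.67) p.234] -/
theorem ineq1101_multiLevelBox_two (d ℓ : ℕ) (hℓ : 1 ≤ ℓ) (aminus aplus a2minus a2plus : ℝ) (ha : 0 < aminus)
    (ha2 : 0 < a2minus) :
    ∃ C' M₀ : ℝ, ∃ N₀ : ℕ, 0 < C' ∧ 0 < M₀ ∧ 0 < N₀ ∧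
      ∀ (k Mh R : ℕ), 3 ≤ Mh → M₀ ≤ ((ℓ : ℝ) + 1) * Mh → 2 * (ℓ + 1) ≤ R → N₀ + 1 ≤ R * ((ℓ + 1) * Mh) →
      ∀ (P : Fin (d + 1) → ℕ) (_hP : ∀ μ, 1 ≤ P μ) (D : Domains d ℓ Mh k P R) (a c : ℕ → ℝ),
        (∀ i, aminus ≤ a i ∧ a i ≤ aplus) → (∀ i, a2minus ≤ c i ∧ c i ≤ a2plus) →
        (∀ i, a (i + 1) = aNext ℓ (a i) (c i)) →
        ∀ (f : ↥(boxDom (N0 ℓ Mh k P)) → ℝ) (S : ℝ), 0 ≤ S →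
          (∀ z : ↥(boxDom (N0 ℓ Mh k P)), |f z| ≤ S * ((((ℓ : ℝ) + 1) ^ D.lev z.1) ^ 2)⁻¹) →
          ∀ x : ↥(boxDom (N0 ℓ Mh k P)),
            |(gml (N0 ℓ Mh k P) ℓ k D.lev a *ᵥ f) x| ≤ C' * S ∧
            (∀ μ : Fin (d + 1), |(dMat (N0 ℓ Mh k P) μ *ᵥ (gml (N0 ℓ Mh k P) ℓ k D.lev a *ᵥ f)) x| ≤
              C' * (((ℓ : ℝ) + 1) ^ D.lev x.1)⁻¹ * S) ∧
            (∀ μ : Fin (d + 1), |(gml (N0 ℓ Mh k P) ℓ k D.lev a *ᵥ ((dMat (N0 ℓ Mh k P) μ)ᵀ *ᵥ f)) x| ≤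
              C' * (((ℓ : ℝ) + 1) ^ D.lev x.1)⁻¹ * S) ∧
            |(opBoxR 1 0 0 1 (N0 ℓ Mh k P) *ᵥ (gml (N0 ℓ Mh k P) ℓ k D.lev a *ᵥ f)) x| ≤
              C' * ((((ℓ : ℝ) + 1) ^ D.lev x.1) ^ 2)⁻¹ * S := by
  obtain ⟨C', M₀, N₀, hC', hM₀, hN₀, h⟩ := ineq1101_multiLevelBox d ℓ hℓ aminus aplus a2minus a2plus ha ha2 2
  refine ⟨C', M₀, N₀, hC', hM₀, hN₀, ?_⟩
  intro k Mh R hMh hM hR hRM P hP D a c haw hcw hac f S hS hf x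
  obtain ⟨h1, h2, h3, h6⟩ := h k Mh R hMh hM hR hRM P hP D a c haw hcw hac f S hS hf x
  have hL0 : (0 : ℝ) < (ℓ : ℝ) + 1 := by positivity
  set lam : ℝ := ((ℓ : ℝ) + 1) ^ D.lev x.1 with hlam
  have hlam0 : 0 < lam := pow_pos hL0 _
  have e1 : C' * lam ^ 2 * (lam ^ 2)⁻¹ * S = C' * S := by field_simp
  have e2 : C' * lam * (lam ^ 2)⁻¹ * S = C' * lam⁻¹ * S := by field_simp
  refine ⟨?_, fun μ => ?_, fun μ => ?_, h6⟩
  · rw [← e1]; exact h1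
  · rw [← e2]; exact h2 μ
  · rw [← e2]; exact h3 μ

end G1101

/-! ## §4  The composite letter `G′R` of (1.100)–(1.101) -/

section GR

/-- **(1.101) FOR THE COMPOSITE `G′R` OF (1.100) AT U₀ = 1 ON THE `k`-LEVEL BOX FAMILY, THE INVERSE ENTERING BY ITS (2.87)-BOUND**
(«λ = G′RD\*A + G′R𝔉₄(λ, Dλ, A, D\*A). (1.100) … Thus we have |G′R𝔉(…)|, |DG′R𝔉(…)|₍₋₁₎ ≦ O(1)B′₀·(the |·|₍₋₂₎-size of 𝔉)»): for
every `C₁, δ₁ > 0` there are `C″, M₀ > 0`, `N₀ ≥ 1` such that on every member of the family, for EVERY `G` with the (2.87)-bound and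
every `f` with `|f(z)| ≦ S(L^{j(z)})⁻²`: `|(G′Rf)(x)| ≦ C″S` and `|(∂_μG′Rf)(x)| ≦ C″(Lʲ)⁻¹S` — §2 at `n = 2` followed by §3 at `n = 2`
(`C″ = C′B′₀`). [cite: Balaban1985RegularSpaces, (1.100)–(1.101) p.93, (1.98) p.92; Balaban1985BackgroundPropagators, Theorem 3.1 (3.42) p.397, (3.47) p.398, (3.49) p.399, (3.25) p.394; Balaban1984PropagatorsII, Prop. 2.2 (2.67) p.234, Prop. 2.3 (2.87) p.238] -/
theorem ineq1101_GR_multiLevelBox_of_inverse (d ℓ : ℕ) (hℓ : 1 ≤ ℓ) (aminus aplus a2minus a2plus : ℝ) (ha : 0 < aminus)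
    (ha2 : 0 < a2minus) {C₁ δ₁ : ℝ} (hC₁ : 0 < C₁) (hδ₁ : 0 < δ₁) :
    ∃ C'' M₀ : ℝ, ∃ N₀ : ℕ, 0 < C'' ∧ 0 < M₀ ∧ 0 < N₀ ∧
      ∀ (k Mh R : ℕ), 3 ≤ Mh → M₀ ≤ ((ℓ : ℝ) + 1) * Mh → 2 * (ℓ + 1) ≤ R → N₀ + 1 ≤ R * ((ℓ + 1) * Mh) →
      ∀ (P : Fin (d + 1) → ℕ) (_hP : ∀ μ, 1 ≤ P μ) (D : Domains d ℓ Mh k P R) (a c : ℕ → ℝ),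
        (∀ i, aminus ≤ a i ∧ a i ≤ aplus) → (∀ i, a2minus ≤ c i ∧ c i ≤ a2plus) →
        (∀ i, a (i + 1) = aNext ℓ (a i) (c i)) →
        ∀ G : Module.End ℝ (↥(bset D) → ℝ),
          (∀ y y' : ↥(bset D), |mat G y y' / W D y'| ≤
            C₁ * (geom D).len y ^ (-(4 : ℝ)) * (geom D).len y' ^ (-((d + 1 : ℕ) : ℝ)) *
              Real.exp (-(δ₁ / 2 * (geom D).dist y y'))) →
          ∀ (f : ↥(boxDom (N0 ℓ Mh k P)) → ℝ) (S : ℝ), 0 ≤ S →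
            (∀ z : ↥(boxDom (N0 ℓ Mh k P)), |f z| ≤ S * ((((ℓ : ℝ) + 1) ^ D.lev z.1) ^ 2)⁻¹) →
            ∀ x : ↥(boxDom (N0 ℓ Mh k P)),
              |(gml (N0 ℓ Mh k P) ℓ k D.lev a *ᵥ rProjML D a G f) x| ≤ C'' * S ∧
              ∀ μ : Fin (d + 1), |(dMat (N0 ℓ Mh k P) μ *ᵥ (gml (N0 ℓ Mh k P) ℓ k D.lev a *ᵥ rProjML D a G f)) x| ≤
                C'' * (((ℓ : ℝ) + 1) ^ D.lev x.1)⁻¹ * S := by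
  obtain ⟨B₀', M₁, N₁, hB₀', hM₁, hN₁, h198⟩ :=
    ineq198R_multiLevelBox_of_inverse d ℓ hℓ aminus aplus a2minus a2plus ha ha2 hC₁ hδ₁ 2
  obtain ⟨C', M₂, N₂, hC', hM₂, hN₂, hG'⟩ := ineq1101_multiLevelBox_two d ℓ hℓ aminus aplus a2minus a2plus ha ha2
  refine ⟨C' * B₀', max M₁ M₂, max N₁ N₂, mul_pos hC' hB₀', lt_max_of_lt_left hM₁, lt_of_lt_of_le hN₁ (le_max_left _ _), ?_⟩
  intro k Mh R hMh hM hR hRM P hP D a c haw hcw hac G hG f S hS hf x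
  have hRM1 : N₁ + 1 ≤ R * ((ℓ + 1) * Mh) := le_trans (Nat.succ_le_succ (le_max_left _ _)) hRM
  have hRM2 : N₂ + 1 ≤ R * ((ℓ + 1) * Mh) := le_trans (Nat.succ_le_succ (le_max_right _ _)) hRM
  -- `|Rf|₍₋₂₎ ≤ B′₀S`
  have hRf : ∀ z : ↥(boxDom (N0 ℓ Mh k P)), |rProjML D a G f z| ≤ B₀' * S * ((((ℓ : ℝ) + 1) ^ D.lev z.1) ^ 2)⁻¹ := by
    intro z
    have h := (h198 k Mh R hMh ((le_max_left _ _).trans hM) hR hRM1 P hP D a c haw hcw hac G hG f S hS hf z).2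
    refine h.trans (le_of_eq ?_); ring
  have hS' : 0 ≤ B₀' * S := mul_nonneg hB₀'.le hS
  obtain ⟨h1, h2, -, -⟩ := hG' k Mh R hMh ((le_max_right _ _).trans hM) hR hRM2 P hP D a c haw hcw hac
    (rProjML D a G f) (B₀' * S) hS' hRf x
  refine ⟨h1.trans (le_of_eq (by ring)), fun μ => (h2 μ).trans (le_of_eq (by ring))⟩

end GR

/-! ## §5  HYPOTHESIS-FREE: `G` = THE inverse `(Q′G′²Q′*)⁻¹` of [B6] Proposition 2.3 on the family (`prop23_multiLevelBox`) -/

section P23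

/-- **(1.98), R-HALF, AT U₀ = 1 ON THE `k`-LEVEL BOX FAMILY — HYPOTHESIS-FREE**: for every exponent `n` there are `B′₀, M₀ > 0`,
`N₀ ≥ 1` (functions of `d, ℓ`, the weight windows and `n`) such that on every member of the family there is an operator `G` on `𝔅`
which is THE two-sided inverse of `Q′G′²Q′*` (`G·(Q′G′²Q′*) = 1 = (Q′G′²Q′*)·G`) and for which `R = 1 − G′Q′*GQ′G′` ([4] (3.25)) and
`P = 1 − R` satisfy `|(Pf)(x)|, |(Rf)(x)| ≦ B′₀(L^{j(x)})⁻ⁿS` whenever `|f(z)| ≦ S(L^{j(z)})⁻ⁿ`; `n = 2` = «|Rf|₍₋₂₎ ≦ B′₀|f|₍₋₂₎».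
[cite: Balaban1985RegularSpaces, (1.98) p.92, (1.27) p.80; Balaban1985BackgroundPropagators, (3.25) p.394, (3.49) p.399; Balaban1984PropagatorsII, Prop. 2.3 (2.87) p.238, p.235 («its inverse is well defined»)] -/
theorem ineq198R_multiLevelBox (d ℓ : ℕ) (hℓ : 1 ≤ ℓ) (aminus aplus a2minus a2plus : ℝ) (ha : 0 < aminus)
    (ha2 : 0 < a2minus) (n : ℕ) :
    ∃ B₀' M₀ : ℝ, ∃ N₀ : ℕ, 0 < B₀' ∧ 0 < M₀ ∧ 0 < N₀ ∧
      ∀ (k Mh R : ℕ), 3 ≤ Mh → M₀ ≤ ((ℓ : ℝ) + 1) * Mh → 2 * (ℓ + 1) ≤ R → N₀ + 1 ≤ R * ((ℓ + 1) * Mh) →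
      ∀ (P : Fin (d + 1) → ℕ) (_hP : ∀ μ, 1 ≤ P μ) (D : Domains d ℓ Mh k P R) (a c : ℕ → ℝ),
        (∀ i, aminus ≤ a i ∧ a i ≤ aplus) → (∀ i, a2minus ≤ c i ∧ c i ≤ a2plus) →
        (∀ i, a (i + 1) = aNext ℓ (a i) (c i)) →
        ∃ G : Module.End ℝ (↥(bset D) → ℝ),
          G * kerOp (W D) (Xk D a) = 1 ∧ kerOp (W D) (Xk D a) * G = 1 ∧
          ∀ (f : ↥(boxDom (N0 ℓ Mh k P)) → ℝ) (S : ℝ), 0 ≤ S →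
            (∀ z : ↥(boxDom (N0 ℓ Mh k P)), |f z| ≤ S * ((((ℓ : ℝ) + 1) ^ D.lev z.1) ^ n)⁻¹) →
            ∀ x : ↥(boxDom (N0 ℓ Mh k P)),
              |pProjML D a G f x| ≤ B₀' * ((((ℓ : ℝ) + 1) ^ D.lev x.1) ^ n)⁻¹ * S ∧
              |rProjML D a G f x| ≤ B₀' * ((((ℓ : ℝ) + 1) ^ D.lev x.1) ^ n)⁻¹ * S := by
  obtain ⟨δ₁, C₁, M₁, hδ₁, hC₁, hM₁, hP5⟩ := prop23_multiLevelBox d ℓ hℓ aminus aplus a2minus a2plus ha ha2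
  obtain ⟨B₀', M₀, N₀, hB, hM₀, hN₀, h⟩ :=
    ineq198R_multiLevelBox_of_inverse d ℓ hℓ aminus aplus a2minus a2plus ha ha2 hC₁ hδ₁ n
  refine ⟨B₀', max M₀ M₁, N₀, hB, lt_max_of_lt_left hM₀, hN₀, ?_⟩
  intro k Mh R hMh hM hR hRM P hP D a c haw hcw hac
  obtain ⟨G, h1, h2, -, -, h5, -⟩ := hP5 k Mh R ((le_max_right _ _).trans hM) hR P hP D a c haw hcw hac
  exact ⟨G, h1, h2, h k Mh R hMh ((le_max_left _ _).trans hM) hR hRM P hP D a c haw hcw hac G h5⟩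

/-- **(1.101) FOR THE COMPOSITE `G′R` OF (1.100) AT U₀ = 1 ON THE `k`-LEVEL BOX FAMILY — HYPOTHESIS-FREE** (`G` = THE inverse):
`|(G′Rf)(x)| ≦ C″S`, `|(∂_μG′Rf)(x)| ≦ C″(Lʲ)⁻¹S` for `|f(z)| ≦ S(L^{j(z)})⁻²`.
[cite: Balaban1985RegularSpaces, (1.100)–(1.101) p.93, (1.98) p.92; Balaban1985BackgroundPropagators, Theorem 3.1 (3.42) p.397, (3.25) p.394; Balaban1984PropagatorsII, Prop. 2.3 (2.87) p.238] -/
theorem ineq1101_GR_multiLevelBox (d ℓ : ℕ) (hℓ : 1 ≤ ℓ) (aminus aplus a2minus a2plus : ℝ) (ha : 0 < aminus)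
    (ha2 : 0 < a2minus) :
    ∃ C'' M₀ : ℝ, ∃ N₀ : ℕ, 0 < C'' ∧ 0 < M₀ ∧ 0 < N₀ ∧
      ∀ (k Mh R : ℕ), 3 ≤ Mh → M₀ ≤ ((ℓ : ℝ) + 1) * Mh → 2 * (ℓ + 1) ≤ R → N₀ + 1 ≤ R * ((ℓ + 1) * Mh) →
      ∀ (P : Fin (d + 1) → ℕ) (_hP : ∀ μ, 1 ≤ P μ) (D : Domains d ℓ Mh k P R) (a c : ℕ → ℝ),
        (∀ i, aminus ≤ a i ∧ a i ≤ aplus) → (∀ i, a2minus ≤ c i ∧ c i ≤ a2plus) →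
        (∀ i, a (i + 1) = aNext ℓ (a i) (c i)) →
        ∃ G : Module.End ℝ (↥(bset D) → ℝ),
          G * kerOp (W D) (Xk D a) = 1 ∧ kerOp (W D) (Xk D a) * G = 1 ∧
          ∀ (f : ↥(boxDom (N0 ℓ Mh k P)) → ℝ) (S : ℝ), 0 ≤ S →
            (∀ z : ↥(boxDom (N0 ℓ Mh k P)), |f z| ≤ S * ((((ℓ : ℝ) + 1) ^ D.lev z.1) ^ 2)⁻¹) →
            ∀ x : ↥(boxDom (N0 ℓ Mh k P)),
              |(gml (N0 ℓ Mh k P) ℓ k D.lev a *ᵥ rProjML D a G f) x| ≤ C'' * S ∧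
              ∀ μ : Fin (d + 1), |(dMat (N0 ℓ Mh k P) μ *ᵥ (gml (N0 ℓ Mh k P) ℓ k D.lev a *ᵥ rProjML D a G f)) x| ≤
                C'' * (((ℓ : ℝ) + 1) ^ D.lev x.1)⁻¹ * S := by
  obtain ⟨δ₁, C₁, M₁, hδ₁, hC₁, hM₁, hP5⟩ := prop23_multiLevelBox d ℓ hℓ aminus aplus a2minus a2plus ha ha2
  obtain ⟨C'', M₀, N₀, hC, hM₀, hN₀, h⟩ :=
    ineq1101_GR_multiLevelBox_of_inverse d ℓ hℓ aminus aplus a2minus a2plus ha ha2 hC₁ hδ₁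
  refine ⟨C'', max M₀ M₁, N₀, hC, lt_max_of_lt_left hM₀, hN₀, ?_⟩
  intro k Mh R hMh hM hR hRM P hP D a c haw hcw hac
  obtain ⟨G, h1, h2, -, -, h5, -⟩ := hP5 k Mh R ((le_max_right _ _).trans hM) hR P hP D a c haw hcw hac
  exact ⟨G, h1, h2, h k Mh R hMh ((le_max_left _ _).trans hM) hR hRM P hP D a c haw hcw hac G h5⟩

end P23

/-! ## §6  In print's own norm `|·|₍α₎` of p. 86 (typed `B8ScaledSupNorm.msup`): the dictionary on the box; (1.98) and (1.101) restated -/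

section MSup

open B8ScaledSupNorm (msup weight Bdd msup_le_of_pointwise norm_le_of_msup_le msup_nonneg)

variable {ℓ Mh k R : ℕ} {P : Fin (d + 1) → ℕ} (D : Domains d ℓ Mh k P R)

/-- the cast of the block side `L = ℓ + 1`. [folklore] -/
private theorem castL (ℓ : ℕ) : (((ℓ + 1 : ℕ) : ℝ)) = (ℓ : ℝ) + 1 := by push_cast; ring

/-- the p. 86 scale factor at `α = −n`, `η = 1`: `((Lʲ·1))^{−n} = ((Lʲ)ⁿ)⁻¹`. [cite: Balaban1985RegularSpaces, p.86 (definition after (1.55))] -/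
private theorem scale_rpow_neg (ℓ j n : ℕ) :
    ((((ℓ + 1 : ℕ) : ℝ)) ^ j * (1 : ℝ)) ^ (-(n : ℝ)) = ((((ℓ : ℝ) + 1) ^ j) ^ n)⁻¹ := by
  rw [mul_one, castL, Real.rpow_neg (pow_nonneg (by positivity) j), Real.rpow_natCast]

/-- **THE p. 86 NORM ON THE BOX IS FINITE** (finite lattice): the weighted family `(Lʲ)ⁿ‖f(z)‖`, `j ≤ k`, is bounded — the side
condition `Bdd` of the typed `sup_j sup_{Ω_j}`. [cite: Balaban1985RegularSpaces, p.86 (definition after (1.55))] -/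
theorem bdd_box (n : ℕ) (f : ↥(boxDom (N0 ℓ Mh k P)) → ℝ) :
    Bdd (ℓ + 1) k 1 (-(n : ℝ)) (fun j (z : ↥(boxDom (N0 ℓ Mh k P))) => j ≤ (B6MultiLevelBoxOperatorL0.Domains.lev D) z.1) f := by
  classical
  refine ⟨∑ z : ↥(boxDom (N0 ℓ Mh k P)), ∑ j ∈ Finset.range (k + 1), weight (ℓ + 1) 1 (-(n : ℝ)) j * ‖f z‖,
    fun j hj z _ => ?_⟩
  have hw : ∀ j' z', 0 ≤ weight (ℓ + 1) 1 (-(n : ℝ)) j' * ‖f z'‖ := fun j' z' =>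
    mul_nonneg (B8ScaledSupNorm.weight_nonneg _ zero_le_one _ _) (norm_nonneg _)
  calc weight (ℓ + 1) 1 (-(n : ℝ)) j * ‖f z‖
      ≤ ∑ j' ∈ Finset.range (k + 1), weight (ℓ + 1) 1 (-(n : ℝ)) j' * ‖f z‖ :=
        Finset.single_le_sum (f := fun j' => weight (ℓ + 1) 1 (-(n : ℝ)) j' * ‖f z‖) (fun j' _ => hw j' z)
          (Finset.mem_range.2 (Nat.lt_succ_of_le hj))
    _ ≤ ∑ z' : ↥(boxDom (N0 ℓ Mh k P)), ∑ j' ∈ Finset.range (k + 1), weight (ℓ + 1) 1 (-(n : ℝ)) j' * ‖f z'‖ :=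
        Finset.single_le_sum (f := fun z' => ∑ j' ∈ Finset.range (k + 1), weight (ℓ + 1) 1 (-(n : ℝ)) j' * ‖f z'‖)
          (fun z' _ => Finset.sum_nonneg fun j' _ => hw j' z') (Finset.mem_univ z)

/-- **DICTIONARY, NORM ⇒ POINTWISE**: on the box, with `Ω_j = {z : j ≤ lev z}` (levels `1 … k`, `Ω₁ = X`) and `η = 1`, the p. 86 bound
`|f|₍₋ₙ₎ ≦ S` gives `|f(z)| ≦ S·(L^{j(z)})⁻ⁿ` at every fine point read at its own level ([4] p. 397 «For α negative we can take Ω_j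
instead of Ω_j∖Ω_{j+1}»). [cite: Balaban1985RegularSpaces, p.86 (definition after (1.55)); Balaban1985BackgroundPropagators, (3.41) p.397] -/
theorem pointwise_of_msup_le (n : ℕ) {f : ↥(boxDom (N0 ℓ Mh k P)) → ℝ} {S : ℝ}
    (h : msup (ℓ + 1) k 1 (-(n : ℝ)) (fun j (z : ↥(boxDom (N0 ℓ Mh k P))) => j ≤ (B6MultiLevelBoxOperatorL0.Domains.lev D) z.1) f ≤ S)
    (z : ↥(boxDom (N0 ℓ Mh k P))) : |f z| ≤ S * ((((ℓ : ℝ) + 1) ^ D.lev z.1) ^ n)⁻¹ := by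
  have h1 := norm_le_of_msup_le (E := ℝ) (by omega : 1 ≤ ℓ + 1) one_pos (bdd_box D n f) h (D.lev_le z.1)
    (i := z) le_rfl
  rw [Real.norm_eq_abs, scale_rpow_neg] at h1
  exact h1

/-- **DICTIONARY, POINTWISE ⇒ NORM**: `|f(z)| ≦ S·(L^{j(z)})⁻ⁿ` at every fine point (`S ≥ 0`) gives the p. 86 bound `|f|₍₋ₙ₎ ≦ S`
(on `Ω_j ∋ z` one has `j ≤ j(z)`, so `(L^{j(z)})⁻ⁿ ≦ (Lʲ)⁻ⁿ`). [cite: Balaban1985RegularSpaces, p.86 (definition after (1.55)); Balaban1985BackgroundPropagators, (3.41) p.397] -/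
theorem msup_le_of_pointwise_box (n : ℕ) {f : ↥(boxDom (N0 ℓ Mh k P)) → ℝ} {S : ℝ} (hS : 0 ≤ S)
    (h : ∀ z : ↥(boxDom (N0 ℓ Mh k P)), |f z| ≤ S * ((((ℓ : ℝ) + 1) ^ (B6MultiLevelBoxOperatorL0.Domains.lev D) z.1) ^ n)⁻¹) :
    msup (ℓ + 1) k 1 (-(n : ℝ)) (fun j (z : ↥(boxDom (N0 ℓ Mh k P))) => j ≤ D.lev z.1) f ≤ S := by
  refine msup_le_of_pointwise (E := ℝ) (by omega : 1 ≤ ℓ + 1) one_pos hS fun j _ z hjz => ?_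
  rw [Real.norm_eq_abs, scale_rpow_neg]
  have hL1 : (1 : ℝ) ≤ (ℓ : ℝ) + 1 := by linarith [(Nat.cast_nonneg ℓ : (0 : ℝ) ≤ ℓ)]
  have hj : (((ℓ : ℝ) + 1) ^ j) ^ n ≤ (((ℓ : ℝ) + 1) ^ D.lev z.1) ^ n :=
    pow_le_pow_left₀ (by positivity) (pow_le_pow_right₀ hL1 hjz) n
  have hjpos : 0 < (((ℓ : ℝ) + 1) ^ j) ^ n := by positivity
  exact (h z).trans (mul_le_mul_of_nonneg_left ((inv_le_inv₀ (by positivity) hjpos).2 hj) hS)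

/-- **(1.98), R-HALF, IN PRINT'S OWN NORM — «|Rf|₍₋₂₎ ≦ B′₀|f|₍₋₂₎» (every exponent `−n`) AT U₀ = 1 ON THE `k`-LEVEL BOX FAMILY,
HYPOTHESIS-FREE**: with `|·|₍α₎ = B8ScaledSupNorm.msup (ℓ+1) k 1 α (Ω_j = {z : j ≤ lev z})` and `G` = THE inverse `(Q′G′²Q′*)⁻¹`:
`|Rf|₍₋ₙ₎ ≦ B′₀|f|₍₋ₙ₎` and `|Pf|₍₋ₙ₎ ≦ B′₀|f|₍₋ₙ₎` for every fine function `f`.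
[cite: Balaban1985RegularSpaces, (1.98) p.92, p.86 (definition after (1.55)), (1.27) p.80; Balaban1985BackgroundPropagators, (3.25) p.394, (3.41) p.397, (3.49) p.399; Balaban1984PropagatorsII, Prop. 2.3 (2.87) p.238] -/
theorem ineq198R_multiLevelBox_msup (d ℓ : ℕ) (hℓ : 1 ≤ ℓ) (aminus aplus a2minus a2plus : ℝ) (ha : 0 < aminus)
    (ha2 : 0 < a2minus) (n : ℕ) :
    ∃ B₀' M₀ : ℝ, ∃ N₀ : ℕ, 0 < B₀' ∧ 0 < M₀ ∧ 0 < N₀ ∧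
      ∀ (k Mh R : ℕ), 3 ≤ Mh → M₀ ≤ ((ℓ : ℝ) + 1) * Mh → 2 * (ℓ + 1) ≤ R → N₀ + 1 ≤ R * ((ℓ + 1) * Mh) →
      ∀ (P : Fin (d + 1) → ℕ) (_hP : ∀ μ, 1 ≤ P μ) (D : Domains d ℓ Mh k P R) (a c : ℕ → ℝ),
        (∀ i, aminus ≤ a i ∧ a i ≤ aplus) → (∀ i, a2minus ≤ c i ∧ c i ≤ a2plus) →
        (∀ i, a (i + 1) = aNext ℓ (a i) (c i)) →
        ∃ G : Module.End ℝ (↥(bset D) → ℝ),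
          G * kerOp (W D) (Xk D a) = 1 ∧ kerOp (W D) (Xk D a) * G = 1 ∧
          ∀ f : ↥(boxDom (N0 ℓ Mh k P)) → ℝ,
            msup (ℓ + 1) k 1 (-(n : ℝ)) (fun j (z : ↥(boxDom (N0 ℓ Mh k P))) => j ≤ D.lev z.1) (rProjML D a G f) ≤
              B₀' * msup (ℓ + 1) k 1 (-(n : ℝ)) (fun j (z : ↥(boxDom (N0 ℓ Mh k P))) => j ≤ D.lev z.1) f ∧
            msup (ℓ + 1) k 1 (-(n : ℝ)) (fun j (z : ↥(boxDom (N0 ℓ Mh k P))) => j ≤ D.lev z.1) (pProjML D a G f) ≤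
              B₀' * msup (ℓ + 1) k 1 (-(n : ℝ)) (fun j (z : ↥(boxDom (N0 ℓ Mh k P))) => j ≤ D.lev z.1) f := by
  obtain ⟨B₀', M₀, N₀, hB, hM₀, hN₀, h⟩ := ineq198R_multiLevelBox d ℓ hℓ aminus aplus a2minus a2plus ha ha2 n
  refine ⟨B₀', M₀, N₀, hB, hM₀, hN₀, ?_⟩
  intro k Mh R hMh hM hR hRM P hP D a c haw hcw hac
  obtain ⟨G, h1, h2, hb⟩ := h k Mh R hMh hM hR hRM P hP D a c haw hcw hac
  refine ⟨G, h1, h2, fun f => ?_⟩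
  set S : ℝ := msup (ℓ + 1) k 1 (-(n : ℝ)) (fun j (z : ↥(boxDom (N0 ℓ Mh k P))) => j ≤ D.lev z.1) f with hSdef
  have hS : 0 ≤ S := msup_nonneg _ _ zero_le_one _ _ _
  have hf := pointwise_of_msup_le D n (le_refl S)
  have hBS : 0 ≤ B₀' * S := mul_nonneg hB.le hS
  refine ⟨msup_le_of_pointwise_box D n hBS fun x => ?_, msup_le_of_pointwise_box D n hBS fun x => ?_⟩
  · exact ((hb f S hS hf x).2).trans (le_of_eq (by ring))
  · exact ((hb f S hS hf x).1).trans (le_of_eq (by ring))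

/-- **(1.101) IN PRINT'S OWN NORMS — «G′ is a bounded operator from a space with the norm |·|₍₋₂₎ into a space with the norm |·| for
functions, and the norm |·|₍₋₁₎ for their first derivatives» AT U₀ = 1 ON THE `k`-LEVEL BOX FAMILY** (genuine `G′`; hypothesis-free):
`|G′f|₍₀₎ ≦ C′|f|₍₋₂₎`, `|∂_μG′f|₍₋₁₎ ≦ C′|f|₍₋₂₎`, `|G′∂*_μf|₍₋₁₎ ≦ C′|f|₍₋₂₎`, `|(−Δ^N)G′f|₍₋₂₎ ≦ C′|f|₍₋₂₎` in the typed p. 86 norm.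
[cite: Balaban1985RegularSpaces, (1.101) p.93, p.86 (definition after (1.55)); Balaban1985BackgroundPropagators, Theorem 3.1 (3.42) p.397, (3.47) p.398, (3.41) p.397; Balaban1984PropagatorsII, Prop. 2.2 (2.67) p.234] -/
theorem ineq1101_multiLevelBox_msup (d ℓ : ℕ) (hℓ : 1 ≤ ℓ) (aminus aplus a2minus a2plus : ℝ) (ha : 0 < aminus)
    (ha2 : 0 < a2minus) :
    ∃ C' M₀ : ℝ, ∃ N₀ : ℕ, 0 < C' ∧ 0 < M₀ ∧ 0 < N₀ ∧
      ∀ (k Mh R : ℕ), 3 ≤ Mh → M₀ ≤ ((ℓ : ℝ) + 1) * Mh → 2 * (ℓ + 1) ≤ R → N₀ + 1 ≤ R * ((ℓ + 1) * Mh) →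
      ∀ (P : Fin (d + 1) → ℕ) (_hP : ∀ μ, 1 ≤ P μ) (D : Domains d ℓ Mh k P R) (a c : ℕ → ℝ),
        (∀ i, aminus ≤ a i ∧ a i ≤ aplus) → (∀ i, a2minus ≤ c i ∧ c i ≤ a2plus) →
        (∀ i, a (i + 1) = aNext ℓ (a i) (c i)) →
        ∀ f : ↥(boxDom (N0 ℓ Mh k P)) → ℝ,
          msup (ℓ + 1) k 1 0 (fun j (z : ↥(boxDom (N0 ℓ Mh k P))) => j ≤ D.lev z.1)
              (gml (N0 ℓ Mh k P) ℓ k D.lev a *ᵥ f) ≤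
            C' * msup (ℓ + 1) k 1 (-2) (fun j (z : ↥(boxDom (N0 ℓ Mh k P))) => j ≤ D.lev z.1) f ∧
          (∀ μ : Fin (d + 1), msup (ℓ + 1) k 1 (-1) (fun j (z : ↥(boxDom (N0 ℓ Mh k P))) => j ≤ D.lev z.1)
              (dMat (N0 ℓ Mh k P) μ *ᵥ (gml (N0 ℓ Mh k P) ℓ k D.lev a *ᵥ f)) ≤
            C' * msup (ℓ + 1) k 1 (-2) (fun j (z : ↥(boxDom (N0 ℓ Mh k P))) => j ≤ D.lev z.1) f) ∧
          (∀ μ : Fin (d + 1), msup (ℓ + 1) k 1 (-1) (fun j (z : ↥(boxDom (N0 ℓ Mh k P))) => j ≤ D.lev z.1)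
              (gml (N0 ℓ Mh k P) ℓ k D.lev a *ᵥ ((dMat (N0 ℓ Mh k P) μ)ᵀ *ᵥ f)) ≤
            C' * msup (ℓ + 1) k 1 (-2) (fun j (z : ↥(boxDom (N0 ℓ Mh k P))) => j ≤ D.lev z.1) f) ∧
          msup (ℓ + 1) k 1 (-2) (fun j (z : ↥(boxDom (N0 ℓ Mh k P))) => j ≤ D.lev z.1)
              (opBoxR 1 0 0 1 (N0 ℓ Mh k P) *ᵥ (gml (N0 ℓ Mh k P) ℓ k D.lev a *ᵥ f)) ≤
            C' * msup (ℓ + 1) k 1 (-2) (fun j (z : ↥(boxDom (N0 ℓ Mh k P))) => j ≤ D.lev z.1) f := by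
  obtain ⟨C', M₀, N₀, hC', hM₀, hN₀, h⟩ := ineq1101_multiLevelBox_two d ℓ hℓ aminus aplus a2minus a2plus ha ha2
  refine ⟨C', M₀, N₀, hC', hM₀, hN₀, ?_⟩
  intro k Mh R hMh hM hR hRM P hP D a c haw hcw hac f
  set S : ℝ := msup (ℓ + 1) k 1 (-2) (fun j (z : ↥(boxDom (N0 ℓ Mh k P))) => j ≤ D.lev z.1) f with hSdef
  have e2 : (-2 : ℝ) = -((2 : ℕ) : ℝ) := by norm_num
  have e1 : (-1 : ℝ) = -((1 : ℕ) : ℝ) := by norm_num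
  have e0 : (0 : ℝ) = -((0 : ℕ) : ℝ) := by norm_num
  have hS : 0 ≤ S := msup_nonneg _ _ zero_le_one _ _ _
  have hf : ∀ z : ↥(boxDom (N0 ℓ Mh k P)), |f z| ≤ S * ((((ℓ : ℝ) + 1) ^ D.lev z.1) ^ 2)⁻¹ := by
    have hle : msup (ℓ + 1) k 1 (-((2 : ℕ) : ℝ)) (fun j (z : ↥(boxDom (N0 ℓ Mh k P))) => j ≤ D.lev z.1) f ≤ S := by
      rw [← e2]
    exact pointwise_of_msup_le D 2 hle
  have hb := h k Mh R hMh hM hR hRM P hP D a c haw hcw hac f S hS hf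
  have hCS : 0 ≤ C' * S := mul_nonneg hC'.le hS
  refine ⟨?_, fun μ => ?_, fun μ => ?_, ?_⟩
  · rw [e0]
    refine msup_le_of_pointwise_box D 0 hCS fun x => ?_
    rw [pow_zero, inv_one, mul_one]
    exact (hb x).1
  · rw [e1]
    refine msup_le_of_pointwise_box D 1 hCS fun x => ?_
    rw [pow_one]
    exact ((hb x).2.1 μ).trans (le_of_eq (by ring))
  · rw [e1]
    refine msup_le_of_pointwise_box D 1 hCS fun x => ?_
    rw [pow_one]
    exact ((hb x).2.2.1 μ).trans (le_of_eq (by ring))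
  · rw [e2]
    refine msup_le_of_pointwise_box D 2 hCS fun x => ?_
    exact ((hb x).2.2.2).trans (le_of_eq (by ring))

end MSup

end

end Literature.MathematicalPhysics.QuantumFieldTheory.Balaban1983to89.B8Ineq198MultiLevelBoxL0
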